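import Mathlib.Analysis.SpecialFunctions.Pow.Deriv
import Mathlib.Analysis.SpecialFunctions.Complex.Arg
import Mathlib.Analysis.Calculus.IteratedDeriv.Lemmas
import Mathlib.Analysis.Calculus.ContDiff.Deriv
import HarnessLib

/-!
# Rohde–Schramm's harmonic-type function `h(z) = Im(θ z^b)` of Lemma 6.5, in slope coordinates

Topic `Probability/RandomPlanarGeometry`; deterministic special-function layer for the discharge of
S. Rohde, O. Schramm, *Basic properties of SLE*, Ann. of Math. 161 (2005), **Lemma 6.5** (p. 906:
"Let `z ∈ ℍ̄ ∖ {0}`. If `κ > 4`, then `P[τ(z) < ∞] = 1`"), whose printed proof (p. 907) starts: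
"Let `b := 1 - 4/κ`, and `θ := exp(iπ(1-b)/2)`. Set `h(z) := Im(θ z^b)`, `z ∈ ℍ̄`. A direct
calculation shows that the drift term in Itô's formula for `(gₜ(z) - ξ(t))^b` is zero. Consequently,
`h(gₜ(z) - ξ(t))` is a local martingale. Note that `κ > 4` implies that `h(z) → ∞` as `z → ∞` in
`ℍ̄`, that `h(z) > 0` in `ℍ̄ ∖ {0}`."

For the tree's Itô calculus of the point flow `zₜ = xₜ + i yₜ` (`SLEPointFlow*`,
`SLERSObservableIto`), functions of `zₜ` are written as `yₜ^b · F(wₜ)` with the slope `w = x/y`: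
since `z = y (w + i)` and `y > 0`, `θ z^b = y^b · θ (w + i)^b`. This file provides, for real `b`
(meant for `b = 1 - 4/κ ∈ (0, 1)`):

* `swallowPow b c w = θ_b (w + i)^c` (complex, `c` real; `c = b, b - 1, b - 2` occur),
  `swallowIm b w = Im(θ_b (w+i)^b)` (`= H`) and `swallowRe b w = Re(θ_b (w+i)^b)` (`= G`);
* derivatives (`hasDerivAt_swallowPow`: `∂_w θ(w+i)^c = c θ (w+i)^{c-1}`), `C²` regularity, and
  **the slope ODE** `(κ/2)(1+w²) F'' + 4w F' - 2b F = 0` for `F = H, G` when `b = 1 - 4/κ`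
  (`swallowIm_ode`, `swallowRe_ode`) — the identity behind "the drift term … is zero": with
  `ζ = w + i`, `(κ/2)(b-1) = -2` and `1 + w² = ζ(w - i)`,
  `(κ/2)(1+w²) b(b-1)ζ^{b-2} + 4wbζ^{b-1} - 2bζ^b = bζ^{b-1}[-2(w-i) + 4w - 2(w+i)] = 0`;
* the polar form `θ (w+i)^c = |w+i|^c (cos + i sin)(π(1-b)/2 + c·arg(w+i))` and the bounds
  `cos(πb/2) |w+i|^b ≤ H(w)`, `|H|, |G| ≤ |w+i|^b`, `sin(πb/2) |w+i|^{b-1} ≤ Re(θ(w+i)^{b-1})`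
  (`= G'(w)/b`) for `0 ≤ b ≤ 1` ("`h(z) > 0`", "`h(z) → ∞`"), and the rescaling
  `y^c |x/y + i|^c = (x² + y²)^{c/2}`.

## References

* S. Rohde, O. Schramm, *Basic properties of SLE*, Ann. of Math. 161 (2005), Lemma 6.5 and its
  proof (pp. 906–907).
-/

noncomputable section

open Set Filter Topology Complex
open scoped Real

namespace Literature.Probability.RandomPlanarGeometry

variable {b c : ℝ}

/-! ### The functions -/

/-- Rohde–Schramm's phase `θ = exp(iπ(1-b)/2)` (proof of Lemma 6.5). [cite: RohdeSchramm2005, Lemma 6.5 (proof)] -/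
def swallowPhase (b : ℝ) : ℂ :=
  Complex.exp (((π * (1 - b) / 2 : ℝ) : ℂ) * I)

/-- `θ_b (w + i)^c` for real `w` and a real exponent `c` (principal branch; `w + i ∈ ℍ` is in the
slit plane): for `c = b` this is `θ z^b / y^b` at `z = y(w + i)`. [cite: RohdeSchramm2005, Lemma 6.5 (proof)] -/
def swallowPow (b c : ℝ) (w : ℝ) : ℂ :=
  swallowPhase b * ((w : ℂ) + I) ^ (c : ℂ)

/-- `H(w) = Im(θ_b (w + i)^b)`: Rohde–Schramm's `h(z) = Im(θ z^b)` divided by `y^b`, as a function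
of the slope `w = x/y`. [cite: RohdeSchramm2005, Lemma 6.5 (proof)] -/
def swallowIm (b : ℝ) (w : ℝ) : ℝ :=
  (swallowPow b b w).im

/-- `G(w) = Re(θ_b (w + i)^b)`: the real part companion of `swallowIm` (also drift-free along the
flow; its `w`-derivative does not vanish, which is what the quadratic-variation argument uses).
[cite: RohdeSchramm2005, Lemma 6.5 (proof)] -/
def swallowRe (b : ℝ) (w : ℝ) : ℝ :=
  (swallowPow b b w).re

/-! ### Elementary facts about `w + i` and `θ` -/

/-- `w + i` lies in the slit plane. [folklore] -/
theorem ofReal_add_I_mem_slitPlane (w : ℝ) : (w : ℂ) + I ∈ slitPlane :=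
  Or.inr (by simp)

/-- `w + i ≠ 0`. [folklore] -/
theorem ofReal_add_I_ne_zero (w : ℝ) : (w : ℂ) + I ≠ 0 :=
  slitPlane_ne_zero (ofReal_add_I_mem_slitPlane w)

/-- `|w + i| = √(w² + 1)`. [folklore] -/
theorem norm_ofReal_add_I (w : ℝ) : ‖(w : ℂ) + I‖ = Real.sqrt (w ^ 2 + 1) := by
  rw [Complex.norm_eq_sqrt_sq_add_sq]
  congr 1
  simp

/-- `|w + i| > 0`. [folklore] -/
theorem norm_ofReal_add_I_pos (w : ℝ) : 0 < ‖(w : ℂ) + I‖ :=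
  norm_pos_iff.2 (ofReal_add_I_ne_zero w)

/-- `arg(w + i) ∈ [0, π]`. [folklore] -/
theorem arg_ofReal_add_I_mem (w : ℝ) : arg ((w : ℂ) + I) ∈ Icc 0 π :=
  ⟨arg_nonneg_iff.2 (by simp), arg_le_pi _⟩

/-- `|θ| = 1`. [folklore] -/
theorem norm_swallowPhase (b : ℝ) : ‖swallowPhase b‖ = 1 :=
  norm_exp_ofReal_mul_I _

/-- `|θ (w+i)^c| = |w+i|^c`. [folklore] -/
theorem norm_swallowPow (b c w : ℝ) : ‖swallowPow b c w‖ = ‖(w : ℂ) + I‖ ^ c := by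
  rw [swallowPow, norm_mul, norm_swallowPhase, one_mul, norm_cpow_real]

/-- Lowering the exponent: `θ(w+i)^c = θ(w+i)^{c-1} · (w+i)`. [folklore] -/
theorem swallowPow_eq_mul (b c w : ℝ) :
    swallowPow b c w = swallowPow b (c - 1) w * ((w : ℂ) + I) := by
  rw [swallowPow, swallowPow, mul_assoc]
  congr 1
  have h : ((c : ℂ)) = ((c - 1 : ℝ) : ℂ) + 1 := by push_cast; ring
  rw [h, cpow_add _ _ (ofReal_add_I_ne_zero w), cpow_one]

/-! ### Derivatives -/

/-- **`∂_w θ(w+i)^c = c θ(w+i)^{c-1}`** (real derivative of the complex-valued function of the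
real variable `w`; chain rule through `z ↦ z^c` on the slit plane). [folklore] -/
theorem hasDerivAt_swallowPow (b c w : ℝ) :
    HasDerivAt (swallowPow b c) ((c : ℂ) * swallowPow b (c - 1) w) w := by
  have h1 : HasDerivAt (fun z : ℂ ↦ swallowPhase b * (z + I) ^ (c : ℂ))
      (swallowPhase b * ((c : ℂ) * ((w : ℂ) + I) ^ ((c : ℂ) - 1) * 1)) (w : ℂ) :=
    (((hasDerivAt_id (w : ℂ)).add_const I).cpow_const (ofReal_add_I_mem_slitPlane w)).const_mul _
  have h2 := h1.comp_ofReal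
  refine h2.congr_deriv ?_
  rw [swallowPow, mul_one]
  have h : ((c : ℂ)) - 1 = ((c - 1 : ℝ) : ℂ) := by push_cast; ring
  rw [h]
  ring

/-- `deriv` form of `hasDerivAt_swallowPow`. [folklore] -/
theorem deriv_swallowPow (b c : ℝ) :
    deriv (swallowPow b c) = fun w ↦ (c : ℂ) * swallowPow b (c - 1) w :=
  funext fun w ↦ (hasDerivAt_swallowPow b c w).deriv

/-- `swallowPow b c` is continuous. [folklore] -/
theorem continuous_swallowPow (b c : ℝ) : Continuous (swallowPow b c) :=
  continuous_iff_continuousAt.2 fun w ↦ (hasDerivAt_swallowPow b c w).continuousAt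

/-- **`H' = b · Im(θ(w+i)^{b-1})`.** [folklore] -/
theorem hasDerivAt_swallowIm (b w : ℝ) :
    HasDerivAt (swallowIm b) (b * (swallowPow b (b - 1) w).im) w := by
  have h := imCLM.hasFDerivAt.comp_hasDerivAt w (hasDerivAt_swallowPow b b w)
  have h' : HasDerivAt (swallowIm b) (imCLM ((b : ℂ) * swallowPow b (b - 1) w)) w := h
  rw [imCLM_apply, im_ofReal_mul] at h'
  exact h'

/-- **`G' = b · Re(θ(w+i)^{b-1})`.** [folklore] -/
theorem hasDerivAt_swallowRe (b w : ℝ) :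
    HasDerivAt (swallowRe b) (b * (swallowPow b (b - 1) w).re) w := by
  have h := reCLM.hasFDerivAt.comp_hasDerivAt w (hasDerivAt_swallowPow b b w)
  have h' : HasDerivAt (swallowRe b) (reCLM ((b : ℂ) * swallowPow b (b - 1) w)) w := h
  rw [reCLM_apply, re_ofReal_mul] at h'
  exact h'

/-- `deriv H`. [folklore] -/
theorem deriv_swallowIm (b : ℝ) : deriv (swallowIm b) = fun w ↦ b * (swallowPow b (b - 1) w).im :=
  funext fun w ↦ (hasDerivAt_swallowIm b w).deriv

/-- `deriv G`. [folklore] -/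
theorem deriv_swallowRe (b : ℝ) : deriv (swallowRe b) = fun w ↦ b * (swallowPow b (b - 1) w).re :=
  funext fun w ↦ (hasDerivAt_swallowRe b w).deriv

/-- The derivative of `w ↦ Im(θ(w+i)^c)` is `c Im(θ(w+i)^{c-1})`. [folklore] -/
theorem hasDerivAt_im_swallowPow (b c w : ℝ) :
    HasDerivAt (fun w ↦ (swallowPow b c w).im) (c * (swallowPow b (c - 1) w).im) w := by
  have h := imCLM.hasFDerivAt.comp_hasDerivAt w (hasDerivAt_swallowPow b c w)
  have h' : HasDerivAt (fun w ↦ (swallowPow b c w).im) (imCLM ((c : ℂ) * swallowPow b (c - 1) w)) w := h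
  rw [imCLM_apply, im_ofReal_mul] at h'
  exact h'

/-- The derivative of `w ↦ Re(θ(w+i)^c)` is `c Re(θ(w+i)^{c-1})`. [folklore] -/
theorem hasDerivAt_re_swallowPow (b c w : ℝ) :
    HasDerivAt (fun w ↦ (swallowPow b c w).re) (c * (swallowPow b (c - 1) w).re) w := by
  have h := reCLM.hasFDerivAt.comp_hasDerivAt w (hasDerivAt_swallowPow b c w)
  have h' : HasDerivAt (fun w ↦ (swallowPow b c w).re) (reCLM ((c : ℂ) * swallowPow b (c - 1) w)) w := h
  rw [reCLM_apply, re_ofReal_mul] at h'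
  exact h'

/-- **`H'' = b(b-1) · Im(θ(w+i)^{b-2})`.** [folklore] -/
theorem hasDerivAt_deriv_swallowIm (b w : ℝ) :
    HasDerivAt (deriv (swallowIm b)) (b * (b - 1) * (swallowPow b (b - 2) w).im) w := by
  rw [deriv_swallowIm]
  have h := (hasDerivAt_im_swallowPow b (b - 1) w).const_mul b
  refine h.congr_deriv ?_
  rw [show b - 1 - 1 = b - 2 by ring]
  ring

/-- **`G'' = b(b-1) · Re(θ(w+i)^{b-2})`.** [folklore] -/
theorem hasDerivAt_deriv_swallowRe (b w : ℝ) :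
    HasDerivAt (deriv (swallowRe b)) (b * (b - 1) * (swallowPow b (b - 2) w).re) w := by
  rw [deriv_swallowRe]
  have h := (hasDerivAt_re_swallowPow b (b - 1) w).const_mul b
  refine h.congr_deriv ?_
  rw [show b - 1 - 1 = b - 2 by ring]
  ring

/-- `iteratedDeriv 2 H`. [folklore] -/
theorem iteratedDeriv_two_swallowIm (b w : ℝ) :
    iteratedDeriv 2 (swallowIm b) w = b * (b - 1) * (swallowPow b (b - 2) w).im := by
  rw [iteratedDeriv_succ, iteratedDeriv_one]
  exact (hasDerivAt_deriv_swallowIm b w).deriv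

/-- `iteratedDeriv 2 G`. [folklore] -/
theorem iteratedDeriv_two_swallowRe (b w : ℝ) :
    iteratedDeriv 2 (swallowRe b) w = b * (b - 1) * (swallowPow b (b - 2) w).re := by
  rw [iteratedDeriv_succ, iteratedDeriv_one]
  exact (hasDerivAt_deriv_swallowRe b w).deriv

/-- **`H` is `C²`.** [folklore] -/
theorem contDiff_two_swallowIm (b : ℝ) : ContDiff ℝ 2 (swallowIm b) := by
  have h : ContDiff ℝ ((1 : ℕ) + 1) (swallowIm b) := by
    rw [contDiff_succ_iff_deriv]
    refine ⟨fun w ↦ (hasDerivAt_swallowIm b w).differentiableAt,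
      fun h ↦ absurd h (by exact_mod_cast WithTop.coe_ne_top), ?_⟩
    rw [show ((1 : ℕ) : WithTop ℕ∞) = 1 from rfl, contDiff_one_iff_deriv]
    refine ⟨fun w ↦ (hasDerivAt_deriv_swallowIm b w).differentiableAt, ?_⟩
    have hd : deriv (deriv (swallowIm b)) = fun w ↦ b * (b - 1) * (swallowPow b (b - 2) w).im :=
      funext fun w ↦ (hasDerivAt_deriv_swallowIm b w).deriv
    rw [hd]
    exact continuous_const.mul (continuous_im.comp (continuous_swallowPow b _))
  exact h

/-- **`G` is `C²`.** [folklore] -/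
theorem contDiff_two_swallowRe (b : ℝ) : ContDiff ℝ 2 (swallowRe b) := by
  have h : ContDiff ℝ ((1 : ℕ) + 1) (swallowRe b) := by
    rw [contDiff_succ_iff_deriv]
    refine ⟨fun w ↦ (hasDerivAt_swallowRe b w).differentiableAt,
      fun h ↦ absurd h (by exact_mod_cast WithTop.coe_ne_top), ?_⟩
    rw [show ((1 : ℕ) : WithTop ℕ∞) = 1 from rfl, contDiff_one_iff_deriv]
    refine ⟨fun w ↦ (hasDerivAt_deriv_swallowRe b w).differentiableAt, ?_⟩
    have hd : deriv (deriv (swallowRe b)) = fun w ↦ b * (b - 1) * (swallowPow b (b - 2) w).re :=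
      funext fun w ↦ (hasDerivAt_deriv_swallowRe b w).deriv
    rw [hd]
    exact continuous_const.mul (continuous_re.comp (continuous_swallowPow b _))
  exact h

/-! ### The slope ODE ("the drift term is zero") -/

/-- **The complex identity behind the vanishing drift**: for `b = 1 - 4/κ`, `κ ≠ 0`, `ζ = w + i`,
`(κ/2)(1+w²) · b(b-1) θζ^{b-2} + 4w · b θζ^{b-1} - 2b · θζ^b = 0` (factor `bθζ^{b-2}·ζ` and
`(κ/2)(b-1) = -2`). Rohde–Schramm (2005), proof of Lemma 6.5: "the drift term in Itô's formula for
`(gₜ(z) - ξ(t))^b` is zero". [cite: RohdeSchramm2005, Lemma 6.5 (proof)] -/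
theorem swallowPow_ode {κ : ℝ} (hκ : κ ≠ 0) (hb : b = 1 - 4 / κ) (w : ℝ) :
    ((κ / 2 * (1 + w ^ 2) : ℝ) : ℂ) * ((b * (b - 1) : ℝ) * swallowPow b (b - 2) w) +
      ((4 * w : ℝ) : ℂ) * ((b : ℝ) * swallowPow b (b - 1) w) -
      ((2 * b : ℝ) : ℂ) * swallowPow b b w = 0 := by
  have e1 : swallowPow b (b - 1) w = swallowPow b (b - 2) w * ((w : ℂ) + I) := by
    rw [swallowPow_eq_mul b (b - 1) w, show b - 1 - 1 = b - 2 by ring]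
  have e2 : swallowPow b b w = swallowPow b (b - 2) w * ((w : ℂ) + I) * ((w : ℂ) + I) := by
    rw [swallowPow_eq_mul b b w, e1]
  rw [e1, e2]
  have hk : κ / 2 * (b - 1) = -2 := by rw [hb]; field_simp; ring
  set P := swallowPow b (b - 2) w
  have key : ((κ / 2 * (1 + w ^ 2) : ℝ) : ℂ) * ((b * (b - 1) : ℝ) * P) +
      ((4 * w : ℝ) : ℂ) * ((b : ℝ) * (P * ((w : ℂ) + I))) -
      ((2 * b : ℝ) : ℂ) * (P * ((w : ℂ) + I) * ((w : ℂ) + I)) =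
      (b : ℂ) * P * (((κ / 2 * (b - 1) : ℝ) : ℂ) * (1 + (w : ℂ) ^ 2) + 4 * w * ((w : ℂ) + I) -
        2 * (((w : ℂ) + I) * ((w : ℂ) + I))) := by
    push_cast; ring
  rw [key, hk]
  have hz : (((-2 : ℝ)) : ℂ) * (1 + (w : ℂ) ^ 2) + 4 * w * ((w : ℂ) + I) -
      2 * (((w : ℂ) + I) * ((w : ℂ) + I)) = 0 := by
    push_cast
    ring_nf
    rw [I_sq]
    ring
  rw [hz, mul_zero]

/-- **The slope ODE for `H = Im(θ(w+i)^b)`**: for `b = 1 - 4/κ`,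
`(κ/2)(1+w²) H'' + 4w H' - 2b H = 0`. [cite: RohdeSchramm2005, Lemma 6.5 (proof)] -/
theorem swallowIm_ode {κ : ℝ} (hκ : κ ≠ 0) (hb : b = 1 - 4 / κ) (w : ℝ) :
    κ / 2 * (1 + w ^ 2) * iteratedDeriv 2 (swallowIm b) w + 4 * w * deriv (swallowIm b) w -
      2 * b * swallowIm b w = 0 := by
  have h := congrArg Complex.im (swallowPow_ode hκ hb w)
  simp only [sub_im, add_im, im_ofReal_mul, zero_im] at h
  rw [iteratedDeriv_two_swallowIm, deriv_swallowIm, swallowIm]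
  linarith

/-- **The slope ODE for `G = Re(θ(w+i)^b)`**: for `b = 1 - 4/κ`,
`(κ/2)(1+w²) G'' + 4w G' - 2b G = 0`. [cite: RohdeSchramm2005, Lemma 6.5 (proof)] -/
theorem swallowRe_ode {κ : ℝ} (hκ : κ ≠ 0) (hb : b = 1 - 4 / κ) (w : ℝ) :
    κ / 2 * (1 + w ^ 2) * iteratedDeriv 2 (swallowRe b) w + 4 * w * deriv (swallowRe b) w -
      2 * b * swallowRe b w = 0 := by
  have h := congrArg Complex.re (swallowPow_ode hκ hb w)
  simp only [sub_re, add_re, re_ofReal_mul, zero_re] at h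
  rw [iteratedDeriv_two_swallowRe, deriv_swallowRe, swallowRe]
  linarith

/-! ### Polar form and bounds -/

/-- **Polar form, real part**: `Re(θ(w+i)^c) = |w+i|^c cos(π(1-b)/2 + c·arg(w+i))`. [folklore] -/
theorem re_swallowPow (b c w : ℝ) :
    (swallowPow b c w).re = ‖(w : ℂ) + I‖ ^ c * Real.cos (π * (1 - b) / 2 + c * arg ((w : ℂ) + I)) := by
  rw [swallowPow, swallowPhase, cpow_def_of_ne_zero (ofReal_add_I_ne_zero w), ← Complex.exp_add,
    Complex.exp_re, Real.rpow_def_of_pos (norm_ofReal_add_I_pos w)]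
  congr 1
  · congr 1
    simp [Complex.log_re]
  · congr 1
    simp [Complex.log_im]
    ring

/-- **Polar form, imaginary part**: `Im(θ(w+i)^c) = |w+i|^c sin(π(1-b)/2 + c·arg(w+i))`. [folklore] -/
theorem im_swallowPow (b c w : ℝ) :
    (swallowPow b c w).im = ‖(w : ℂ) + I‖ ^ c * Real.sin (π * (1 - b) / 2 + c * arg ((w : ℂ) + I)) := by
  rw [swallowPow, swallowPhase, cpow_def_of_ne_zero (ofReal_add_I_ne_zero w), ← Complex.exp_add,
    Complex.exp_im, Real.rpow_def_of_pos (norm_ofReal_add_I_pos w)]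
  congr 1
  · congr 1
    simp [Complex.log_re]
  · congr 1
    simp [Complex.log_im]
    ring

/-- `|Im(θ(w+i)^c)| ≤ |w+i|^c`. [folklore] -/
theorem abs_im_swallowPow_le (b c w : ℝ) : |(swallowPow b c w).im| ≤ ‖(w : ℂ) + I‖ ^ c := by
  rw [← norm_swallowPow b c w]
  exact abs_im_le_norm _

/-- `|Re(θ(w+i)^c)| ≤ |w+i|^c`. [folklore] -/
theorem abs_re_swallowPow_le (b c w : ℝ) : |(swallowPow b c w).re| ≤ ‖(w : ℂ) + I‖ ^ c := by
  rw [← norm_swallowPow b c w]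
  exact abs_re_le_norm _

/-- **`H(w) ≥ cos(πb/2) |w+i|^b` for `0 ≤ b ≤ 1`** ("`h(z) > 0` in `ℍ̄ ∖ {0}`", "`h(z) → ∞` as
`z → ∞`", Rohde–Schramm p. 907): the angle `π(1-b)/2 + b·arg(w+i)` is within `bπ/2` of `π/2`.
[cite: RohdeSchramm2005, Lemma 6.5 (proof)] -/
theorem cos_mul_le_swallowIm (hb0 : 0 ≤ b) (hb1 : b ≤ 1) (w : ℝ) :
    Real.cos (π * b / 2) * ‖(w : ℂ) + I‖ ^ b ≤ swallowIm b w := by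
  rw [swallowIm, im_swallowPow, mul_comm]
  refine mul_le_mul_of_nonneg_left ?_ (Real.rpow_nonneg (norm_nonneg _) _)
  obtain ⟨h0, hπ⟩ := arg_ofReal_add_I_mem w
  set A := arg ((w : ℂ) + I) with hA
  have hsin : Real.sin (π * (1 - b) / 2 + b * A) = Real.cos (b * (A - π / 2)) := by
    rw [← Real.cos_sub_pi_div_two]
    congr 1
    ring
  rw [hsin, ← Real.cos_abs (b * (A - π / 2))]
  refine Real.cos_le_cos_of_nonneg_of_le_pi (abs_nonneg _) ?_ ?_
  · nlinarith [Real.pi_pos]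
  · rw [abs_mul, abs_of_nonneg hb0]
    have : |A - π / 2| ≤ π / 2 := abs_le.2 ⟨by linarith, by linarith⟩
    calc b * |A - π / 2| ≤ b * (π / 2) := mul_le_mul_of_nonneg_left this hb0
      _ = π * b / 2 := by ring

/-- **`Re(θ(w+i)^{b-1}) ≥ sin(πb/2) |w+i|^{b-1}` for `0 ≤ b ≤ 1`**: the angle
`π(1-b)/2 + (b-1)arg(w+i) = (1-b)(π/2 - arg(w+i))` is at most `(1-b)π/2` in absolute value. This
makes `G'(w) = b Re(θ(w+i)^{b-1})` bounded below by `b sin(πb/2)|w+i|^{b-1} > 0`.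
[cite: RohdeSchramm2005, Lemma 6.5 (proof)] -/
theorem sin_mul_le_re_swallowPow_sub_one (hb0 : 0 ≤ b) (hb1 : b ≤ 1) (w : ℝ) :
    Real.sin (π * b / 2) * ‖(w : ℂ) + I‖ ^ (b - 1) ≤ (swallowPow b (b - 1) w).re := by
  rw [re_swallowPow, mul_comm]
  refine mul_le_mul_of_nonneg_left ?_ (Real.rpow_nonneg (norm_nonneg _) _)
  obtain ⟨h0, hπ⟩ := arg_ofReal_add_I_mem w
  set A := arg ((w : ℂ) + I) with hA
  have hcos : Real.cos (π * (1 - b) / 2 + (b - 1) * A) = Real.cos ((1 - b) * (π / 2 - A)) := by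
    congr 1
    ring
  have hsin : Real.sin (π * b / 2) = Real.cos ((1 - b) * (π / 2)) := by
    rw [← Real.cos_pi_div_two_sub]
    congr 1
    ring
  rw [hcos, hsin, ← Real.cos_abs ((1 - b) * (π / 2 - A))]
  refine Real.cos_le_cos_of_nonneg_of_le_pi (abs_nonneg _) ?_ ?_
  · nlinarith [Real.pi_pos]
  · rw [abs_mul, abs_of_nonneg (by linarith : 0 ≤ 1 - b)]
    have : |π / 2 - A| ≤ π / 2 := abs_le.2 ⟨by linarith, by linarith⟩
    exact mul_le_mul_of_nonneg_left this (by linarith)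

/-- **Rescaling to the point `z = x + iy`**: for `y > 0` and real `c`,
`y^c · |x/y + i|^c = (√(x² + y²))^c` (`= |z|^c`). [folklore] -/
theorem rpow_mul_norm_slope_rpow {x y : ℝ} (hy : 0 < y) (c : ℝ) :
    y ^ c * ‖((x / y : ℝ) : ℂ) + I‖ ^ c = Real.sqrt (x ^ 2 + y ^ 2) ^ c := by
  rw [← Real.mul_rpow hy.le (norm_nonneg _), norm_ofReal_add_I]
  congr 1
  rw [← Real.sqrt_sq hy.le, ← Real.sqrt_mul (sq_nonneg _), Real.sqrt_sq hy.le]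
  congr 1
  field_simp

/-- `|w + i| ≥ 1`. [folklore] -/
theorem one_le_norm_ofReal_add_I (w : ℝ) : 1 ≤ ‖(w : ℂ) + I‖ := by
  rw [norm_ofReal_add_I]
  calc (1 : ℝ) = Real.sqrt 1 := Real.sqrt_one.symm
    _ ≤ Real.sqrt (w ^ 2 + 1) := Real.sqrt_le_sqrt (by nlinarith)

end Literature.Probability.RandomPlanarGeometry
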